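import Literature.Barriers.RiemannHypothesis.MollifierLimitationsPropAInputs
import Literature.NumberTheory.LFunctions.EulerMaclaurinZetaHigher
import Mathlib.Analysis.SpecialFunctions.SmoothTransition
import Mathlib.Analysis.SpecialFunctions.Sqrt
import Mathlib.Analysis.Calculus.IteratedDeriv.Lemmas
import HarnessLib

/-!
# Radziwiłł 2012, Lemma 2 (Bombieri–Friedlander's smoothed approximation of `ζ`) — discharged

This file proves the named fact
`Literature.Barriers.RiemannHypothesis.Radziwill2012_lemma2` of
`MollifierLimitationsPropAInputs.lean` (M. Radziwiłł, *Limitations to mollifying `ζ(s)`*,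
arXiv:1207.6583, §2, Lemma 2, citing E. Bombieri, J. B. Friedlander, *Dirichlet polynomial
approximations to zeta functions*, Ann. Sc. Norm. Super. Pisa (4) 22 (1995), Prop. 2): for every
`η, v > 0` there is a smooth `w` with `0 ≤ w ≤ 1`, `w(0) = 1`, and `C, T₀` such that for `T ≥ T₀`
and `T ≤ t ≤ 2T`,
`‖ζ(½ + it) − Σ_{n ≤ T^{1+η}} w(n/T^{1+η}) n^{−½−it}‖ ≤ C T^{−v}`
(`Radziwill2012_lemma2_holds`, at the end of the file). It was the last named fact in the
deduction of Radziwiłł's Proposition A (`Radziwill2012_propA_of_lemma2`,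
`MollifierLimitationsPropAProofs.lean`). Everything here is PROVED; there are no named facts.

## The proof (elementary; not the printed one)

Bombieri–Friedlander prove their Proposition 2 by Mellin inversion and a contour shift, which
needs the growth of `ζ` in left half-planes. We give instead a real-variable proof by
**Euler–Maclaurin summation of high order, applied twice at the same point**. Write
`s = ½ + it`, `X = T^{1+η}`, `N₁ = ⌊X⌋`, `N₀ = ⌊X/4⌋`, and take the explicit weight
`w(x) = smoothTransition(3 − 4x)` (`Lemma2.bump`: `w = 1` on `x ≤ ½`, `w = 0` on `x ≥ ¾`).

1. *`ζ` side* (the tree's `Literature.NumberTheory.LFunctions.riemannZeta_eq_eulerMaclaurin_of_re_pos`,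
   Edwards §6.4): `ζ(s) = Σ_{n<N₀} n^{−s} + N₀^{1−s}/(s−1) + ½N₀^{−s} + Σ_{k≤ν} T_k(N₀,s) + R_ν`,
   `‖R_ν‖ ≪_ν |s|^{2ν+1} N₀^{−2ν−½}` (`norm_emRemHigher_le`).
2. *Smooth side*: a general Euler–Maclaurin formula of order `ν` for a *family of derivatives*
   `g_{j+1} = g_j'` on an integer interval (`Lemma2.eulerMaclaurin_family`, proved here from
   `B̄_{k+1}' = (k+1)B̄_k` by the same unit-interval integration by parts as the tree's `ζ` case),
   applied on `[N₀, N₁]` to `g_0(u) = w(u/X) u^{−s}` and its derivatives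
   `g_j = Σ_i C(j,i) X^{−i} w^{(i)}(u/X) · p_{j−i}(u)`, `p_k(u) = (−1)^k s(s+1)⋯(s+k−1) u^{−s−k}`
   (`Lemma2.gFam`, Leibniz rule for families `Lemma2.hasDerivAt_leibnizFamily`). Since `w(·/X) ≡ 1`
   near `N₀` and `≡ 0` near `N₁`, the boundary terms are *exactly* `−½N₀^{−s} + Σ_k T_k(N₀,s)`
   at `N₀` and `0` at `N₁`.
3. Subtracting, every boundary and correction term cancels (`Lemma2.zeta_sub_smoothSum_eq`):
   `ζ(s) − Σ_n w(n/X) n^{−s} = [N₀^{1−s}/(s−1) − ∫_{N₀}^{N₁} w(u/X) u^{−s} du] + R_ν − R_ν^{(g)}`.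
4. One integration by parts turns the bracket into `(X⁻¹√X/(1−s)) ∫ H₀(u/X) u^{−it} du` with
   `H₀ = w'·√·` (the polar terms `N₀^{1−s}/(s−1)` cancel; `Lemma2.polar_sub_integral_eq`), and `k`
   further integrations by parts (`H_{j+1}(x) = −x H_j'(x)`, all supported in `[½, ¾]`;
   `Lemma2.integral_HFam_cpow_eq`) give `O_k(√X · T^{−k−1})`.
5. Both remainders are `O_ν(T^{2ν+1} X^{−2ν−½}) = O(T^{½ − η(2ν+½)})` (`Lemma2.norm_emRem_le`,
   `Lemma2.norm_Rg_le`); with `ν ≥ (v+1)/η`, `k ≥ v + η` and `T₀ = 8` this is `≤ C T^{−v}`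
   (`Lemma2.lemma2_bound`).

## References

* [Radziwill2012] M. Radziwiłł, *Limitations to mollifying ζ(s)*, arXiv:1207.6583 (2012), §2,
  Lemma 2.
* [BombieriFriedlander1995] E. Bombieri, J. B. Friedlander, *Dirichlet polynomial approximations
  to zeta functions*, Ann. Scuola Norm. Sup. Pisa Cl. Sci. (4) 22 (1995), 517–544, Proposition 2.
* [Edwards1974] H. M. Edwards, *Riemann's Zeta Function* (1974), §6.4 (Euler–Maclaurin for `ζ`;
  the tree's `EulerMaclaurinZetaHigher.lean`).
-/

noncomputable section

open Complex Real Set MeasureTheory intervalIntegral Filter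
open scoped Topology ContDiff Interval

namespace Literature.Barriers.RiemannHypothesis

namespace Lemma2

open Literature.NumberTheory.LFunctions

/-! ## §1 Euler–Maclaurin summation of arbitrary order for a family of derivatives -/

section EulerMaclaurin

variable {g : ℕ → ℝ → ℂ} {a b : ℕ}

/-- Interval integrability of `B̄_k · f` for `f` continuous on `[a, b]`. [folklore] -/
theorem intervalIntegrable_bernoulliPer_mul {f : ℝ → ℂ} {a b : ℝ} (hab : a ≤ b)
    (hf : ContinuousOn f (Icc a b)) (k : ℕ) :
    IntervalIntegrable (fun x ↦ (bernoulliPer k x : ℂ) * f x) volume a b := by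
  obtain ⟨β, -, hβ⟩ := exists_bound_bernoulliPer k
  rw [intervalIntegrable_iff_integrableOn_Ioc_of_le hab]
  have hfi : IntegrableOn f (Ioc a b) :=
    (hf.integrableOn_compact isCompact_Icc).mono_set Ioc_subset_Icc_self
  refine Integrable.bdd_mul (c := β) hfi ?_ (ae_of_all _ fun x ↦ ?_)
  · exact (Complex.continuous_ofReal.measurable.comp (measurable_bernoulliPer k)).aestronglyMeasurable
  · rw [Complex.norm_real, Real.norm_eq_abs]; exact hβ x

/-- Continuity of every member of a derivative family on `[a, b]`. [folklore] -/
theorem continuousOn_of_derivFamily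
    (hg : ∀ j, ∀ x ∈ Icc (a : ℝ) b, HasDerivAt (g j) (g (j + 1) x) x) (j : ℕ) {c d : ℝ}
    (hc : (a : ℝ) ≤ c) (hd : d ≤ b) : ContinuousOn (g j) (Icc c d) := fun x hx ↦
  (hg j x ⟨hc.trans hx.1, hx.2.trans hd⟩).continuousAt.continuousWithinAt

/-- **Order one on a unit interval**: `∫ₙ^{n+1} B̄₁ g' = (g(n+1) + g(n))/2 − ∫ₙ^{n+1} g`
(`B̄₁(x) = x − n − ½` on `[n, n+1)`). [folklore] -/
theorem em_unit_one (hg : ∀ j, ∀ x ∈ Icc (a : ℝ) b, HasDerivAt (g j) (g (j + 1) x) x)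
    {n : ℕ} (han : a ≤ n) (hnb : n + 1 ≤ b) :
    ∫ x in (n : ℝ)..(n + 1), (bernoulliPer 1 x : ℂ) * g 1 x =
      (g 0 (n + 1) + g 0 n) / 2 - ∫ x in (n : ℝ)..(n + 1), g 0 x := by
  have han' : (a : ℝ) ≤ n := by exact_mod_cast han
  have hnb' : (n : ℝ) + 1 ≤ b := by exact_mod_cast hnb
  have hle : (n : ℝ) ≤ n + 1 := by linarith
  set U : ℝ → ℂ := fun x ↦ ((x - n - 1 / 2 : ℝ) : ℂ) with hU
  have hderU : ∀ x ∈ uIcc (n : ℝ) (n + 1), HasDerivAt U 1 x := by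
    intro x _
    have h1 : HasDerivAt (fun x : ℝ ↦ x - n - 1 / 2) 1 x := by
      simpa using ((hasDerivAt_id x).sub_const (n : ℝ)).sub_const (1 / 2 : ℝ)
    simpa [hU] using h1.ofReal_comp
  have hderV : ∀ x ∈ uIcc (n : ℝ) (n + 1), HasDerivAt (g 0) (g 1 x) x := by
    intro x hx
    rw [uIcc_of_le hle] at hx
    exact hg 0 x ⟨han'.trans hx.1, hx.2.trans hnb'⟩
  have hc1 : ContinuousOn (g 1) (Icc (n : ℝ) (n + 1)) := continuousOn_of_derivFamily hg 1 han' hnb'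
  have hc0 : ContinuousOn (g 0) (Icc (n : ℝ) (n + 1)) := continuousOn_of_derivFamily hg 0 han' hnb'
  have hIBP := intervalIntegral.integral_mul_deriv_eq_deriv_mul hderU hderV
    ((continuous_const : Continuous fun _ : ℝ ↦ (1 : ℂ)).intervalIntegrable (n : ℝ) (n + 1))
    (hc1.intervalIntegrable_of_Icc hle)
  have hUn : U n = -(1 / 2 : ℂ) := by simp [hU]
  have hUn1 : U (n + 1) = (1 / 2 : ℂ) := by
    simp only [hU]; push_cast; ring
  rw [hUn, hUn1] at hIBP
  -- replace `U` by `B̄₁` a.e.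
  have hae : ∀ᵐ x : ℝ, x ∈ Ι (n : ℝ) (n + 1) →
      (bernoulliPer 1 x : ℂ) * g 1 x = U x * g 1 x := by
    filter_upwards [ae_ne_real ((n : ℝ) + 1)] with x hx hmem
    rw [uIoc_of_le hle] at hmem
    have hIco : x ∈ Ico ((n : ℤ) : ℝ) ((n : ℤ) + 1) := by
      push_cast
      exact ⟨hmem.1.le, lt_of_le_of_ne hmem.2 hx⟩
    rw [bernoulliPer_eq_of_mem_Ico 1 hIco, bernoulliFun_one]
    simp only [hU]
    push_cast
    ring
  rw [integral_congr_ae hae, hIBP]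
  simp only [one_mul]
  ring

/-- **Euler–Maclaurin of order one** for a derivative family on `[a, b]`:
`Σ_{a<n≤b} g(n) = ∫_a^b g + (g(b) − g(a))/2 + ∫_a^b B̄₁ g'`. [folklore] -/
theorem em_order_one (hg : ∀ j, ∀ x ∈ Icc (a : ℝ) b, HasDerivAt (g j) (g (j + 1) x) x)
    (hab : a ≤ b) :
    ∑ n ∈ Finset.Ioc a b, g 0 n = (∫ x in (a : ℝ)..b, g 0 x) + (g 0 b - g 0 a) / 2 +
      ∫ x in (a : ℝ)..b, (bernoulliPer 1 x : ℂ) * g 1 x := by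
  -- induction on the length, keeping `hg` on the big interval
  suffices H : ∀ L : ℕ, a + L ≤ b →
      ∑ n ∈ Finset.Ioc a (a + L), g 0 n = (∫ x in (a : ℝ)..(a + L : ℕ), g 0 x) +
        (g 0 (a + L : ℕ) - g 0 a) / 2 +
        ∫ x in (a : ℝ)..(a + L : ℕ), (bernoulliPer 1 x : ℂ) * g 1 x by
    have := H (b - a) (by omega)
    rwa [show a + (b - a) = b by omega] at this
  intro L hL
  induction L with
  | zero => simp
  | succ L ih =>
    have hL' : a + L ≤ b := by omega
    have h1 : (a : ℝ) ≤ (a + L : ℕ) := by exact_mod_cast Nat.le_add_right a L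
    have h2 : ((a + L : ℕ) : ℝ) ≤ (a + (L + 1) : ℕ) := by push_cast; linarith
    have h2b : ((a + (L + 1) : ℕ) : ℝ) ≤ b := by exact_mod_cast hL
    have hcast : ((a + (L + 1) : ℕ) : ℝ) = ((a + L : ℕ) : ℝ) + 1 := by push_cast; ring
    have hunit := em_unit_one hg (n := a + L) (Nat.le_add_right a L) (by omega)
    rw [show a + (L + 1) = (a + L) + 1 by ring, Finset.sum_Ioc_succ_top (by omega), ih hL']
    have eA := (intervalIntegral.integral_add_adjacent_intervals
      ((continuousOn_of_derivFamily hg 0 le_rfl (h2.trans h2b)).intervalIntegrable_of_Icc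
        (μ := volume) h1)
      ((continuousOn_of_derivFamily hg 0 h1 h2b).intervalIntegrable_of_Icc
        (μ := volume) h2)).symm
    have eB := (intervalIntegral.integral_add_adjacent_intervals
      (intervalIntegrable_bernoulliPer_mul h1
        (continuousOn_of_derivFamily hg 1 le_rfl (h2.trans h2b)) 1)
      (intervalIntegrable_bernoulliPer_mul h2 (continuousOn_of_derivFamily hg 1 h1 h2b) 1)).symm
    rw [show (a + L + 1 : ℕ) = a + (L + 1) by ring, eA, eB, hcast, hunit]
    push_cast
    ring

/-- **The integration-by-parts recursion on a unit interval** (`k ≥ 1`):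
`∫ₙ^{n+1} B̄_k g_k = (B_{k+1}/(k+1)) (g_k(n+1) − g_k(n)) − (1/(k+1)) ∫ₙ^{n+1} B̄_{k+1} g_{k+1}`,
using `B_{k+1}' = (k+1) B_k` and `B_{k+1}(1) = B_{k+1}(0)`. [folklore] -/
theorem em_unit_succ (hg : ∀ j, ∀ x ∈ Icc (a : ℝ) b, HasDerivAt (g j) (g (j + 1) x) x)
    {k : ℕ} (hk : 1 ≤ k) {n : ℕ} (han : a ≤ n) (hnb : n + 1 ≤ b) :
    ∫ x in (n : ℝ)..(n + 1), (bernoulliPer k x : ℂ) * g k x =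
      (bernoulli (k + 1) : ℂ) / (k + 1) * (g k (n + 1) - g k n) -
        1 / (k + 1) * ∫ x in (n : ℝ)..(n + 1), (bernoulliPer (k + 1) x : ℂ) * g (k + 1) x := by
  have han' : (a : ℝ) ≤ n := by exact_mod_cast han
  have hnb' : (n : ℝ) + 1 ≤ b := by exact_mod_cast hnb
  have hle : (n : ℝ) ≤ n + 1 := by linarith
  have hk1 : (k : ℂ) + 1 ≠ 0 := by exact_mod_cast Nat.succ_ne_zero k
  set U : ℝ → ℂ := fun x ↦ (bernoulliFun (k + 1) (x - n) : ℂ) / (k + 1) with hU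
  set U' : ℝ → ℂ := fun x ↦ (bernoulliFun k (x - n) : ℂ) with hU'
  have hderU : ∀ x ∈ uIcc (n : ℝ) (n + 1), HasDerivAt U (U' x) x := by
    intro x _
    have h1 : HasDerivAt (fun x : ℝ ↦ x - n) 1 x := (hasDerivAt_id x).sub_const _
    have h2 := (hasDerivAt_bernoulliFun (k + 1) (x - n)).comp x h1
    have h3 := (h2.ofReal_comp).div_const ((k : ℂ) + 1)
    refine h3.congr_deriv ?_
    simp only [hU', Nat.add_sub_cancel, mul_one]
    push_cast
    field_simp
  have hderV : ∀ x ∈ uIcc (n : ℝ) (n + 1), HasDerivAt (g k) (g (k + 1) x) x := by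
    intro x hx
    rw [uIcc_of_le hle] at hx
    exact hg k x ⟨han'.trans hx.1, hx.2.trans hnb'⟩
  have hcU' : Continuous U' := by
    simp only [hU']
    exact continuous_ofReal.comp ((continuous_bernoulliFun (k := k)).comp (continuous_sub_right _))
  have hck1 : ContinuousOn (g (k + 1)) (Icc (n : ℝ) (n + 1)) :=
    continuousOn_of_derivFamily hg (k + 1) han' hnb'
  have hIBP := intervalIntegral.integral_deriv_mul_eq_sub hderU hderV
    (hcU'.intervalIntegrable _ _) (hck1.intervalIntegrable_of_Icc hle)
  have hu1 : U ((n : ℝ) + 1) = (bernoulli (k + 1) : ℂ) / (k + 1) := by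
    simp only [hU, add_sub_cancel_left]
    rw [bernoulliFun_endpoints_eq_of_ne_one (by omega), bernoulliFun_eval_zero]
    push_cast; rfl
  have hu0 : U (n : ℝ) = (bernoulli (k + 1) : ℂ) / (k + 1) := by
    simp only [hU, sub_self, bernoulliFun_eval_zero]
    push_cast; rfl
  have hint1 : IntervalIntegrable (fun x ↦ U' x * g k x) volume (n : ℝ) (n + 1) :=
    (hcU'.continuousOn.mul (continuousOn_of_derivFamily hg k han' hnb')).intervalIntegrable_of_Icc hle
  have hint2 : IntervalIntegrable (fun x ↦ U x * g (k + 1) x) volume (n : ℝ) (n + 1) := by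
    have hcU : Continuous U := by
      simp only [hU]
      exact (continuous_ofReal.comp
        ((continuous_bernoulliFun (k := k + 1)).comp (continuous_sub_right _))).div_const _
    exact (hcU.continuousOn.mul hck1).intervalIntegrable_of_Icc hle
  rw [intervalIntegral.integral_add hint1 hint2, hu1, hu0] at hIBP
  have hae : ∀ᵐ x : ℝ, x ∈ Ι (n : ℝ) (n + 1) →
      (bernoulliPer k x : ℂ) * g k x = U' x * g k x := by
    filter_upwards [ae_ne_real ((n : ℝ) + 1)] with x hx hmem
    rw [uIoc_of_le hle] at hmem
    have hIco : x ∈ Ico ((n : ℤ) : ℝ) ((n : ℤ) + 1) := by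
      push_cast
      exact ⟨hmem.1.le, lt_of_le_of_ne hmem.2 hx⟩
    simp only [hU', bernoulliPer_eq_of_mem_Ico k hIco]
    push_cast; ring_nf
  have hae' : ∀ᵐ x : ℝ, x ∈ Ι (n : ℝ) (n + 1) →
      U x * g (k + 1) x = (1 / (k + 1)) * ((bernoulliPer (k + 1) x : ℂ) * g (k + 1) x) := by
    filter_upwards [ae_ne_real ((n : ℝ) + 1)] with x hx hmem
    rw [uIoc_of_le hle] at hmem
    have hIco : x ∈ Ico ((n : ℤ) : ℝ) ((n : ℤ) + 1) := by
      push_cast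
      exact ⟨hmem.1.le, lt_of_le_of_ne hmem.2 hx⟩
    simp only [hU, bernoulliPer_eq_of_mem_Ico (k + 1) hIco]
    push_cast
    field_simp
  have hI1 : ∫ x in (n : ℝ)..(n + 1), (bernoulliPer k x : ℂ) * g k x =
      ∫ x in (n : ℝ)..(n + 1), U' x * g k x := integral_congr_ae hae
  have hI2 : ∫ x in (n : ℝ)..(n + 1), U x * g (k + 1) x = (1 / (k + 1)) *
      ∫ x in (n : ℝ)..(n + 1), (bernoulliPer (k + 1) x : ℂ) * g (k + 1) x := by
    rw [← intervalIntegral.integral_const_mul]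
    exact integral_congr_ae hae'
  rw [hI1]
  rw [hI2] at hIBP
  linear_combination hIBP

/-- Summing the recursion over `[a, b]` (`k ≥ 1`):
`∫_a^b B̄_k g_k = (B_{k+1}/(k+1)) (g_k(b) − g_k(a)) − (1/(k+1)) ∫_a^b B̄_{k+1} g_{k+1}`. [folklore] -/
theorem em_recursion (hg : ∀ j, ∀ x ∈ Icc (a : ℝ) b, HasDerivAt (g j) (g (j + 1) x) x)
    {k : ℕ} (hk : 1 ≤ k) (hab : a ≤ b) :
    ∫ x in (a : ℝ)..b, (bernoulliPer k x : ℂ) * g k x =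
      (bernoulli (k + 1) : ℂ) / (k + 1) * (g k b - g k a) -
        1 / (k + 1) * ∫ x in (a : ℝ)..b, (bernoulliPer (k + 1) x : ℂ) * g (k + 1) x := by
  suffices H : ∀ L : ℕ, a + L ≤ b →
      ∫ x in (a : ℝ)..(a + L : ℕ), (bernoulliPer k x : ℂ) * g k x =
        (bernoulli (k + 1) : ℂ) / (k + 1) * (g k (a + L : ℕ) - g k a) -
          1 / (k + 1) * ∫ x in (a : ℝ)..(a + L : ℕ), (bernoulliPer (k + 1) x : ℂ) * g (k + 1) x by
    have := H (b - a) (by omega)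
    rwa [show a + (b - a) = b by omega] at this
  intro L hL
  induction L with
  | zero => simp
  | succ L ih =>
    have hL' : a + L ≤ b := by omega
    have h1 : (a : ℝ) ≤ (a + L : ℕ) := by exact_mod_cast Nat.le_add_right a L
    have h2 : ((a + L : ℕ) : ℝ) ≤ (a + (L + 1) : ℕ) := by push_cast; linarith
    have h2b : ((a + (L + 1) : ℕ) : ℝ) ≤ b := by exact_mod_cast hL
    have hcast : ((a + (L + 1) : ℕ) : ℝ) = ((a + L : ℕ) : ℝ) + 1 := by push_cast; ring
    have hunit := em_unit_succ hg hk (n := a + L) (Nat.le_add_right a L) (by omega)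
    have eA := (intervalIntegral.integral_add_adjacent_intervals
      (intervalIntegrable_bernoulliPer_mul h1
        (continuousOn_of_derivFamily hg k le_rfl (h2.trans h2b)) k)
      (intervalIntegrable_bernoulliPer_mul h2 (continuousOn_of_derivFamily hg k h1 h2b) k)).symm
    have eB := (intervalIntegral.integral_add_adjacent_intervals
      (intervalIntegrable_bernoulliPer_mul h1
        (continuousOn_of_derivFamily hg (k + 1) le_rfl (h2.trans h2b)) (k + 1))
      (intervalIntegrable_bernoulliPer_mul h2
        (continuousOn_of_derivFamily hg (k + 1) h1 h2b) (k + 1))).symm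
    rw [eA, eB, ih hL', hcast, hunit]
    ring

/-- **Euler–Maclaurin summation of order `ν` for a derivative family** (`g_{j+1} = g_j'` on
`[a, b]`, integers `a ≤ b`):
`Σ_{a<n≤b} g(n) = ∫_a^b g + (g(b) − g(a))/2 + Σ_{k=1}^{ν} (B_{2k}/(2k)!) (g_{2k−1}(b) − g_{2k−1}(a))`
`  + (1/(2ν+1)!) ∫_a^b B̄_{2ν+1} g_{2ν+1}`. [folklore] -/
theorem eulerMaclaurin_family (hg : ∀ j, ∀ x ∈ Icc (a : ℝ) b, HasDerivAt (g j) (g (j + 1) x) x)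
    (hab : a ≤ b) (ν : ℕ) :
    ∑ n ∈ Finset.Ioc a b, g 0 n = (∫ x in (a : ℝ)..b, g 0 x) + (g 0 b - g 0 a) / 2 +
      ∑ k ∈ Finset.Icc 1 ν, (bernoulli (2 * k) : ℂ) / (2 * k).factorial *
        (g (2 * k - 1) b - g (2 * k - 1) a) +
      1 / (2 * ν + 1).factorial *
        ∫ x in (a : ℝ)..b, (bernoulliPer (2 * ν + 1) x : ℂ) * g (2 * ν + 1) x := by
  induction ν with
  | zero =>
    rw [em_order_one hg hab]
    simp
  | succ ν ih =>
    rw [ih, Finset.sum_Icc_succ_top (by omega)]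
    have hr1 := em_recursion hg (k := 2 * ν + 1) (by omega) hab
    have hr2 := em_recursion hg (k := 2 * ν + 2) (by omega) hab
    have hB : bernoulli (2 * ν + 2 + 1) = 0 := by
      rw [bernoulli, bernoulli'_eq_zero_of_odd ⟨ν + 1, by ring⟩ (by omega), mul_zero]
    have e1 : ((2 * ν + 1 : ℕ) : ℂ) + 1 = ((2 * ν + 2 : ℕ) : ℂ) := by push_cast; ring
    have e2 : ((2 * ν + 2 : ℕ) : ℂ) + 1 = ((2 * ν + 3 : ℕ) : ℂ) := by push_cast; ring
    rw [show 2 * ν + 1 + 1 = 2 * ν + 2 by ring, e1] at hr1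
    rw [hB, show 2 * ν + 2 + 1 = 2 * ν + 3 by ring, e2, Rat.cast_zero, zero_div, zero_mul,
      zero_sub] at hr2
    rw [show 2 * (ν + 1) - 1 = 2 * ν + 1 by omega, show 2 * (ν + 1) = 2 * ν + 2 by ring,
      show 2 * ν + 2 + 1 = 2 * ν + 3 by ring, hr1, hr2]
    have hf1 : (((2 * ν + 2).factorial : ℕ) : ℂ) =
        ((2 * ν + 2 : ℕ) : ℂ) * (((2 * ν + 1).factorial : ℕ) : ℂ) := by
      rw [show 2 * ν + 2 = (2 * ν + 1) + 1 by ring, Nat.factorial_succ, Nat.cast_mul]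
    have hf2 : (((2 * ν + 3).factorial : ℕ) : ℂ) =
        ((2 * ν + 3 : ℕ) : ℂ) * (((2 * ν + 2).factorial : ℕ) : ℂ) := by
      rw [show 2 * ν + 3 = (2 * ν + 2) + 1 by ring, Nat.factorial_succ, Nat.cast_mul]
    rw [hf2, hf1]
    have hne1 : (((2 * ν + 1).factorial : ℕ) : ℂ) ≠ 0 := by exact_mod_cast Nat.factorial_ne_zero _
    have hne2 : ((2 * ν + 2 : ℕ) : ℂ) ≠ 0 := by exact_mod_cast (show (2 * ν + 2 : ℕ) ≠ 0 by omega)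
    have hne3 : ((2 * ν + 3 : ℕ) : ℂ) ≠ 0 := by exact_mod_cast (show (2 * ν + 3 : ℕ) ≠ 0 by omega)
    generalize (((2 * ν + 1).factorial : ℕ) : ℂ) = F at *
    generalize ((2 * ν + 2 : ℕ) : ℂ) = A at *
    generalize ((2 * ν + 3 : ℕ) : ℂ) = B at *
    field_simp
    ring

end EulerMaclaurin


/-! ## §2 The Leibniz rule for derivative families -/

/-- **Leibniz rule for families.** If `F_{i+1} = F_i'` and `G_{i+1} = G_i'` at `x`, then
`L_j := Σ_{i ≤ j} C(j,i) F_i G_{j−i}` satisfies `L_j' = L_{j+1}` at `x`. [folklore] -/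
theorem hasDerivAt_leibnizFamily {F G : ℕ → ℝ → ℂ} {x : ℝ}
    (hF : ∀ i, HasDerivAt (F i) (F (i + 1) x) x) (hG : ∀ i, HasDerivAt (G i) (G (i + 1) x) x)
    (j : ℕ) :
    HasDerivAt (fun y ↦ ∑ i ∈ Finset.range (j + 1), ((j.choose i : ℕ) : ℂ) * (F i y * G (j - i) y))
      (∑ i ∈ Finset.range (j + 2), (((j + 1).choose i : ℕ) : ℂ) * (F i x * G (j + 1 - i) x)) x := by
  have h := HasDerivAt.fun_sum (u := Finset.range (j + 1))
    (A := fun i y ↦ ((j.choose i : ℕ) : ℂ) * (F i y * G (j - i) y))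
    (fun i _ ↦ ((hF i).mul (hG (j - i))).const_mul ((j.choose i : ℕ) : ℂ))
  refine h.congr_deriv ?_
  rw [Finset.sum_choose_succ_mul (fun i k ↦ F i x * G k x) j]
  simp only [mul_add, Finset.sum_add_distrib]
  rw [add_comm]
  congr 1
  refine Finset.sum_congr rfl fun i hi ↦ ?_
  rw [Finset.mem_range] at hi
  rw [show j + 1 - i = j - i + 1 by omega]

/-! ## §3 The smooth weight `w` and its derivatives -/

/-- The smooth weight of Lemma 2: `w(x) = smoothTransition(3 − 4x)`, so `w = 1` on `x ≤ 1/2`,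
`w = 0` on `x ≥ 3/4`, `0 ≤ w ≤ 1`, `w ∈ C^∞`. [cite: Radziwill2012, Lemma 2] -/
def bump (x : ℝ) : ℝ := Real.smoothTransition (3 - 4 * x)

/-- [folklore] -/
theorem bump_contDiff : ContDiff ℝ ∞ bump :=
  Real.smoothTransition.contDiff.comp (contDiff_const.sub (contDiff_const.mul contDiff_id))

/-- [folklore] -/
theorem bump_nonneg (x : ℝ) : 0 ≤ bump x := Real.smoothTransition.nonneg _

/-- [folklore] -/
theorem bump_le_one (x : ℝ) : bump x ≤ 1 := Real.smoothTransition.le_one _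

/-- [folklore] -/
theorem bump_eq_one {x : ℝ} (hx : x ≤ 1 / 2) : bump x = 1 :=
  Real.smoothTransition.one_of_one_le (by linarith)

/-- [folklore] -/
theorem bump_eq_zero {x : ℝ} (hx : 3 / 4 ≤ x) : bump x = 0 :=
  Real.smoothTransition.zero_of_nonpos (by linarith)

/-- [folklore] -/
theorem bump_zero : bump 0 = 1 := bump_eq_one (by norm_num)

/-- The derivatives `w^{(i)}`. [folklore] -/
def bumpD (i : ℕ) : ℝ → ℝ := iteratedDeriv i bump

/-- [folklore] -/
theorem bumpD_zero : bumpD 0 = bump := iteratedDeriv_zero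

/-- `(w^{(i)})' = w^{(i+1)}`. [folklore] -/
theorem hasDerivAt_bumpD (i : ℕ) (x : ℝ) : HasDerivAt (bumpD i) (bumpD (i + 1) x) x := by
  have hd : Differentiable ℝ (iteratedDeriv i bump) :=
    bump_contDiff.differentiable_iteratedDeriv i (WithTop.coe_lt_coe.2 (ENat.coe_lt_top i))
  rw [bumpD, bumpD, iteratedDeriv_succ]
  exact (hd x).hasDerivAt

/-- [folklore] -/
theorem continuous_bumpD (i : ℕ) : Continuous (bumpD i) :=
  bump_contDiff.continuous_iteratedDeriv i (WithTop.coe_le_coe.2 le_top)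

/-- Left of `1/2` the weight is constant, so `w^{(i)} = 0` there for `i ≥ 1`. [folklore] -/
theorem bumpD_eq_zero_of_lt_half {i : ℕ} (hi : i ≠ 0) {x : ℝ} (hx : x < 1 / 2) : bumpD i x = 0 := by
  have h : bump =ᶠ[𝓝 x] fun _ ↦ (1 : ℝ) := by
    filter_upwards [Iio_mem_nhds hx] with y hy using bump_eq_one (le_of_lt hy)
  rw [bumpD, h.iteratedDeriv_eq, iteratedDeriv_const, if_neg hi]

/-- Right of `3/4` the weight vanishes with all its derivatives. [folklore] -/
theorem bumpD_eq_zero_of_gt {i : ℕ} {x : ℝ} (hx : 3 / 4 < x) : bumpD i x = 0 := by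
  have h : bump =ᶠ[𝓝 x] fun _ ↦ (0 : ℝ) := by
    filter_upwards [Ioi_mem_nhds hx] with y hy using bump_eq_zero (le_of_lt hy)
  rw [bumpD, h.iteratedDeriv_eq, iteratedDeriv_const]
  split_ifs <;> rfl

/-- Every `w^{(i)}` is bounded. [folklore] -/
theorem exists_bound_bumpD (i : ℕ) : ∃ K : ℝ, 1 ≤ K ∧ ∀ x, |bumpD i x| ≤ K := by
  obtain ⟨K₀, hK₀⟩ := isCompact_Icc.exists_bound_of_continuousOn
    ((continuous_bumpD i).continuousOn (s := Icc (1 / 4 : ℝ) 1))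
  refine ⟨max K₀ 1, le_max_right _ _, fun x ↦ ?_⟩
  by_cases hx1 : x < 1 / 2
  · rcases Nat.eq_zero_or_pos i with rfl | hi
    · rw [bumpD_zero, bump_eq_one hx1.le]; simp
    · rw [bumpD_eq_zero_of_lt_half (Nat.pos_iff_ne_zero.1 hi) hx1]; simp
  by_cases hx2 : 3 / 4 < x
  · rw [bumpD_eq_zero_of_gt hx2]; simp
  push Not at hx1 hx2
  have := hK₀ x ⟨by linarith, by linarith⟩
  rw [Real.norm_eq_abs] at this
  exact this.trans (le_max_left _ _)

/-- A fixed choice of bounds `K_i ≥ 1` with `|w^{(i)}| ≤ K_i`. [folklore] -/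
def bumpBound (i : ℕ) : ℝ := Classical.choose (exists_bound_bumpD i)

/-- [folklore] -/
theorem one_le_bumpBound (i : ℕ) : 1 ≤ bumpBound i := (Classical.choose_spec (exists_bound_bumpD i)).1

/-- [folklore] -/
theorem abs_bumpD_le (i : ℕ) (x : ℝ) : |bumpD i x| ≤ bumpBound i :=
  (Classical.choose_spec (exists_bound_bumpD i)).2 x

/-! ## §4 The power family, the scaled weight family and their Leibniz product -/

/-- `p_k(u) = (−1)^k s(s+1)⋯(s+k−1) u^{−(s+k)}`, the `k`-th derivative of `u ↦ u^{−s}`. [folklore] -/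
def powFam (s : ℂ) (k : ℕ) (u : ℝ) : ℂ := (-1) ^ k * emPoch s k * (u : ℂ) ^ (-(s + k))

/-- [folklore] -/
theorem powFam_zero (s : ℂ) (u : ℝ) : powFam s 0 u = (u : ℂ) ^ (-s) := by simp [powFam]

/-- `p_k' = p_{k+1}` on `u > 0`. [folklore] -/
theorem hasDerivAt_powFam (s : ℂ) (k : ℕ) {u : ℝ} (hu : 0 < u) :
    HasDerivAt (powFam s k) (powFam s (k + 1) u) u := by
  have h := (hasDerivAt_ofReal_cpow hu (-(s + k))).const_mul ((-1) ^ k * emPoch s k)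
  have e : (-1) ^ k * emPoch s k * (-(s + ↑k) * (u : ℂ) ^ (-(s + ↑k) - 1)) = powFam s (k + 1) u := by
    rw [powFam, emPoch_succ, pow_succ]
    push_cast
    ring_nf
  rw [← e]
  exact h

/-- `‖p_k(u)‖ = ‖s⋯(s+k−1)‖ u^{−(Re s + k)}` for `u > 0`. [folklore] -/
theorem norm_powFam (s : ℂ) (k : ℕ) {u : ℝ} (hu : 0 < u) :
    ‖powFam s k u‖ = ‖emPoch s k‖ * u ^ (-(s.re + k)) := by
  rw [powFam, norm_mul, norm_mul, norm_pow, norm_neg, norm_one, one_pow, one_mul,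
    Complex.norm_cpow_eq_rpow_re_of_pos hu]
  simp

/-- `‖s(s+1)⋯(s+k−1)‖ ≤ (‖s‖ + k)^k`. [folklore] -/
theorem norm_emPoch_le_pow (s : ℂ) (k : ℕ) : ‖emPoch s k‖ ≤ (‖s‖ + k) ^ k := by
  unfold emPoch
  rw [norm_prod]
  calc ∏ j ∈ Finset.range k, ‖s + (j : ℂ)‖ ≤ ∏ _j ∈ Finset.range k, (‖s‖ + k) := by
        refine Finset.prod_le_prod (fun _ _ ↦ norm_nonneg _) fun j hj ↦ ?_
        rw [Finset.mem_range] at hj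
        calc ‖s + (j : ℂ)‖ ≤ ‖s‖ + ‖(j : ℂ)‖ := norm_add_le _ _
          _ ≤ ‖s‖ + k := by
              rw [Complex.norm_natCast]
              gcongr
    _ = (‖s‖ + k) ^ k := by rw [Finset.prod_const, Finset.card_range]

/-- The scaled weight family `F_i(u) = X^{−i} w^{(i)}(u/X)` (as a complex number). [folklore] -/
def bumpFam (X : ℝ) (i : ℕ) (u : ℝ) : ℂ := (((X ^ i)⁻¹ * bumpD i (u / X) : ℝ) : ℂ)

/-- `F_i' = F_{i+1}`. [folklore] -/
theorem hasDerivAt_bumpFam {X : ℝ} (hX : 0 < X) (i : ℕ) (u : ℝ) :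
    HasDerivAt (bumpFam X i) (bumpFam X (i + 1) u) u := by
  have h1 : HasDerivAt (fun u : ℝ ↦ u / X) (1 / X) u := by
    simpa using (hasDerivAt_id u).div_const X
  have h2 := (hasDerivAt_bumpD i (u / X)).comp u h1
  have h3 := (h2.const_mul ((X ^ i)⁻¹)).ofReal_comp
  have e : (((X ^ i)⁻¹ * (bumpD (i + 1) (u / X) * (1 / X)) : ℝ) : ℂ) = bumpFam X (i + 1) u := by
    unfold bumpFam
    push_cast
    have hX0 : (X : ℂ) ≠ 0 := by exact_mod_cast hX.ne'
    field_simp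
    ring
  rw [← e]
  exact h3

/-- [folklore] -/
theorem bumpFam_zero_apply (X u : ℝ) : bumpFam X 0 u = (bump (u / X) : ℂ) := by
  simp [bumpFam, bumpD_zero]

/-- [folklore] -/
theorem bumpFam_eq_zero_of_lt {X : ℝ} {i : ℕ} (hi : i ≠ 0) {u : ℝ} (hu : u / X < 1 / 2) :
    bumpFam X i u = 0 := by
  simp [bumpFam, bumpD_eq_zero_of_lt_half hi hu]

/-- [folklore] -/
theorem bumpFam_eq_zero_of_gt {X : ℝ} (i : ℕ) {u : ℝ} (hu : 3 / 4 < u / X) : bumpFam X i u = 0 := by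
  simp [bumpFam, bumpD_eq_zero_of_gt hu]

/-- `‖F_i(u)‖ ≤ X^{−i} K_i`. [folklore] -/
theorem norm_bumpFam_le {X : ℝ} (hX : 0 < X) (i : ℕ) (u : ℝ) :
    ‖bumpFam X i u‖ ≤ (X ^ i)⁻¹ * bumpBound i := by
  rw [bumpFam, Complex.norm_real, Real.norm_eq_abs, abs_mul, abs_inv, abs_of_pos (pow_pos hX i)]
  exact mul_le_mul_of_nonneg_left (abs_bumpD_le i _) (by positivity)

/-- The Leibniz family `g_j = Σ_{i≤j} C(j,i) F_i p_{j−i}`: the successive derivatives of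
`g_0(u) = w(u/X) u^{−s}`. [folklore] -/
def gFam (s : ℂ) (X : ℝ) (j : ℕ) (u : ℝ) : ℂ :=
  ∑ i ∈ Finset.range (j + 1), ((j.choose i : ℕ) : ℂ) * (bumpFam X i u * powFam s (j - i) u)

/-- `g_j' = g_{j+1}` on `u > 0`. [folklore] -/
theorem hasDerivAt_gFam (s : ℂ) {X : ℝ} (hX : 0 < X) {u : ℝ} (hu : 0 < u) (j : ℕ) :
    HasDerivAt (gFam s X j) (gFam s X (j + 1) u) u :=
  hasDerivAt_leibnizFamily (fun i ↦ hasDerivAt_bumpFam hX i u) (fun i ↦ hasDerivAt_powFam s i hu) j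

/-- `g_0(u) = w(u/X) u^{−s}`. [folklore] -/
theorem gFam_zero_apply (s : ℂ) (X u : ℝ) : gFam s X 0 u = (bump (u / X) : ℂ) * (u : ℂ) ^ (-s) := by
  simp [gFam, bumpFam_zero_apply, powFam_zero]

/-- Where `w(·/X) ≡ 1` (i.e. `u/X < 1/2`), `g_j = p_j`. [folklore] -/
theorem gFam_eq_powFam (s : ℂ) {X u : ℝ} (hu : u / X < 1 / 2) (j : ℕ) :
    gFam s X j u = powFam s j u := by
  rw [gFam, Finset.sum_range_succ', Finset.sum_eq_zero]
  · simp [bumpFam_zero_apply, bump_eq_one hu.le]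
  · intro i _
    rw [bumpFam_eq_zero_of_lt (Nat.succ_ne_zero i) hu]
    simp

/-- Where `w(·/X) ≡ 0` (i.e. `u/X > 3/4`), `g_j = 0`. [folklore] -/
theorem gFam_eq_zero (s : ℂ) {X u : ℝ} (hu : 3 / 4 < u / X) (j : ℕ) : gFam s X j u = 0 := by
  rw [gFam]
  refine Finset.sum_eq_zero fun i _ ↦ ?_
  rw [bumpFam_eq_zero_of_gt i hu]
  simp

/-- **Size of `g_m`**: for `0 < Y ≤ u`, `Y ≤ X` and `Re s ≥ 0`,
`‖g_m(u)‖ ≤ (Σ_i C(m,i) K_i) (‖s‖ + m)^m Y^{−(Re s + m)}`. [folklore] -/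
theorem norm_gFam_le (s : ℂ) {X Y u : ℝ} (hY : 0 < Y) (hYu : Y ≤ u) (hYX : Y ≤ X) (hs : 0 ≤ s.re)
    (m : ℕ) :
    ‖gFam s X m u‖ ≤ (∑ i ∈ Finset.range (m + 1), (m.choose i : ℝ) * bumpBound i) *
      (‖s‖ + m) ^ m * Y ^ (-(s.re + m)) := by
  have hu : 0 < u := hY.trans_le hYu
  have hX : 0 < X := hY.trans_le hYX
  rw [gFam, Finset.sum_mul, Finset.sum_mul]
  refine (norm_sum_le _ _).trans (Finset.sum_le_sum fun i hi ↦ ?_)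
  rw [Finset.mem_range] at hi
  rw [norm_mul, norm_mul, Complex.norm_natCast, norm_powFam s (m - i) hu]
  have h1 : ‖bumpFam X i u‖ ≤ (X ^ i)⁻¹ * bumpBound i := norm_bumpFam_le hX i u
  have hK : 1 ≤ bumpBound i := one_le_bumpBound i
  -- `X^{-i} ≤ Y^{-i}` and `u^{-(re s + (m - i))} ≤ Y^{-(re s + (m-i))}`
  have h2 : (X ^ i)⁻¹ ≤ (Y ^ i)⁻¹ := by
    rw [inv_le_inv₀ (pow_pos hX i) (pow_pos hY i)]
    exact pow_le_pow_left₀ hY.le hYX i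
  have h3 : u ^ (-(s.re + ((m - i : ℕ) : ℝ))) ≤ Y ^ (-(s.re + ((m - i : ℕ) : ℝ))) :=
    Real.rpow_le_rpow_of_nonpos hY hYu (by simp only [Left.neg_nonpos_iff]; positivity)
  have h4 : ‖emPoch s (m - i)‖ ≤ (‖s‖ + m) ^ m := by
    refine (norm_emPoch_le_pow s (m - i)).trans ?_
    have hmi : ((m - i : ℕ) : ℝ) ≤ m := by exact_mod_cast Nat.sub_le m i
    calc (‖s‖ + ((m - i : ℕ) : ℝ)) ^ (m - i) ≤ (‖s‖ + m) ^ (m - i) := by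
          gcongr
      _ ≤ (‖s‖ + m) ^ m := by
          rcases Nat.eq_zero_or_pos m with hm | hm
          · subst hm
            have hi0 : i = 0 := by omega
            subst hi0
            simp
          · refine pow_le_pow_right₀ ?_ (Nat.sub_le m i)
            have : (1 : ℝ) ≤ m := by exact_mod_cast hm
            linarith [norm_nonneg s]
  have h5 : (Y ^ i)⁻¹ * Y ^ (-(s.re + ((m - i : ℕ) : ℝ))) = Y ^ (-(s.re + m)) := by
    rw [← Real.rpow_natCast, ← Real.rpow_neg hY.le, ← Real.rpow_add hY]
    congr 1
    push_cast [Nat.cast_sub (Nat.lt_succ_iff.1 hi)]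
    ring
  calc (m.choose i : ℝ) * (‖bumpFam X i u‖ * (‖emPoch s (m - i)‖ * u ^ (-(s.re + ((m - i : ℕ) : ℝ)))))
      ≤ (m.choose i : ℝ) * (((Y ^ i)⁻¹ * bumpBound i) *
          ((‖s‖ + m) ^ m * Y ^ (-(s.re + ((m - i : ℕ) : ℝ))))) := by
        gcongr
        · exact h1.trans (mul_le_mul_of_nonneg_right h2 (by linarith))
    _ = (m.choose i : ℝ) * bumpBound i * (‖s‖ + m) ^ m *
          ((Y ^ i)⁻¹ * Y ^ (-(s.re + ((m - i : ℕ) : ℝ)))) := by ring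
    _ = (m.choose i : ℝ) * bumpBound i * (‖s‖ + m) ^ m * Y ^ (-(s.re + m)) := by rw [h5]


/-! ## §5 The oscillatory integral `∫ w'(u/X) u^{1-s} du`: `k`-fold integration by parts -/

/-- `H_0 = w' · √·` and `H_{j+1}(x) = −x · H_j'(x)`: the functions produced by integrating
`∫ H_j(u/X) u^{−it} du` by parts. [folklore] -/
def HFam : ℕ → ℝ → ℝ
  | 0 => fun x ↦ bumpD 1 x * Real.sqrt x
  | j + 1 => fun x ↦ -x * deriv (HFam j) x

/-- [folklore] -/
theorem HFam_succ_apply (j : ℕ) (x : ℝ) : HFam (j + 1) x = -x * deriv (HFam j) x := rfl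

/-- Every `H_j` is smooth on `(0, ∞)`. [folklore] -/
theorem contDiffOn_HFam (j : ℕ) : ContDiffOn ℝ ∞ (HFam j) (Ioi 0) := by
  induction j with
  | zero =>
    have h1 : ContDiff ℝ ∞ (bumpD 1) := by
      rw [bumpD, iteratedDeriv_one]
      exact (contDiff_infty_iff_deriv.1 bump_contDiff).2
    have h2 : ContDiffOn ℝ ∞ Real.sqrt (Ioi 0) := fun x hx ↦
      (Real.contDiffAt_sqrt (ne_of_gt hx)).contDiffWithinAt
    exact h1.contDiffOn.mul h2
  | succ j ih =>
    have hd : ContDiffOn ℝ ∞ (deriv (HFam j)) (Ioi 0) :=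
      ih.deriv_of_isOpen isOpen_Ioi (le_of_eq rfl)
    have : HFam (j + 1) = fun x ↦ -x * deriv (HFam j) x := rfl
    rw [this]
    exact (contDiffOn_id.neg).mul hd

/-- `H_j` vanishes on `(−∞, 1/2)`. [folklore] -/
theorem HFam_eq_zero_of_lt (j : ℕ) {x : ℝ} (hx : x < 1 / 2) : HFam j x = 0 := by
  induction j generalizing x with
  | zero =>
    show bumpD 1 x * Real.sqrt x = 0
    rw [bumpD_eq_zero_of_lt_half one_ne_zero hx, zero_mul]
  | succ j ih =>
    rw [HFam_succ_apply]
    have h : HFam j =ᶠ[𝓝 x] fun _ ↦ (0 : ℝ) := by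
      filter_upwards [Iio_mem_nhds hx] with y hy using ih hy
    rw [h.deriv_eq, deriv_const, mul_zero]

/-- `H_j` vanishes on `(3/4, ∞)`. [folklore] -/
theorem HFam_eq_zero_of_gt (j : ℕ) {x : ℝ} (hx : 3 / 4 < x) : HFam j x = 0 := by
  induction j generalizing x with
  | zero =>
    show bumpD 1 x * Real.sqrt x = 0
    rw [bumpD_eq_zero_of_gt hx, zero_mul]
  | succ j ih =>
    rw [HFam_succ_apply]
    have h : HFam j =ᶠ[𝓝 x] fun _ ↦ (0 : ℝ) := by
      filter_upwards [Ioi_mem_nhds hx] with y hy using ih hy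
    rw [h.deriv_eq, deriv_const, mul_zero]

/-- [folklore] -/
theorem hasDerivAt_HFam (j : ℕ) {x : ℝ} (hx : 0 < x) : HasDerivAt (HFam j) (deriv (HFam j) x) x :=
  ((((contDiffOn_HFam j).differentiableOn (by simp)) x hx).differentiableAt
    (Ioi_mem_nhds hx)).hasDerivAt

/-- [folklore] -/
theorem continuousOn_deriv_HFam (j : ℕ) : ContinuousOn (deriv (HFam j)) (Ioi 0) :=
  ((contDiffOn_HFam j).deriv_of_isOpen (m := ∞) isOpen_Ioi (le_of_eq rfl)).continuousOn

/-- Every `H_j` is bounded on `(0, ∞)`. [folklore] -/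
theorem exists_bound_HFam (j : ℕ) : ∃ M : ℝ, 0 ≤ M ∧ ∀ x, 0 < x → |HFam j x| ≤ M := by
  have hsub : Icc (1 / 2 : ℝ) (3 / 4) ⊆ Ioi 0 := fun x hx ↦ by
    simp only [mem_Ioi]; linarith [hx.1]
  obtain ⟨M₀, hM₀⟩ := (isCompact_Icc : IsCompact (Icc (1 / 2 : ℝ) (3 / 4))).exists_bound_of_continuousOn
    ((contDiffOn_HFam j).continuousOn.mono hsub)
  refine ⟨max M₀ 0, le_max_right _ _, fun x _ ↦ ?_⟩
  by_cases h1 : x < 1 / 2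
  · rw [HFam_eq_zero_of_lt j h1]; simp
  by_cases h2 : 3 / 4 < x
  · rw [HFam_eq_zero_of_gt j h2]; simp
  push Not at h1 h2
  have := hM₀ x ⟨h1, h2⟩
  rw [Real.norm_eq_abs] at this
  exact this.trans (le_max_left _ _)

/-- A fixed bound `M_j ≥ 0` for `|H_j|` on `(0, ∞)`. [folklore] -/
def HBound (j : ℕ) : ℝ := Classical.choose (exists_bound_HFam j)

/-- [folklore] -/
theorem HBound_nonneg (j : ℕ) : 0 ≤ HBound j := (Classical.choose_spec (exists_bound_HFam j)).1

/-- [folklore] -/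
theorem abs_HFam_le (j : ℕ) {x : ℝ} (hx : 0 < x) : |HFam j x| ≤ HBound j :=
  (Classical.choose_spec (exists_bound_HFam j)).2 x hx

/-- **One integration by parts**: for `0 < A ≤ B` with `A/X < 1/2`, `B/X > 3/4` (so `H_j(·/X)`
vanishes at both ends),
`∫_A^B H_j(u/X) u^{−it} du = (1 − it)⁻¹ ∫_A^B H_{j+1}(u/X) u^{−it} du`. [folklore] -/
theorem integral_HFam_cpow_succ (j : ℕ) (t : ℝ) {X A B : ℝ} (hX : 0 < X) (hA : 0 < A)
    (hAB : A ≤ B) (hAX : A / X < 1 / 2) (hBX : 3 / 4 < B / X) :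
    ∫ u in A..B, (HFam j (u / X) : ℂ) * (u : ℂ) ^ (-(t * I)) =
      1 / (1 - t * I) * ∫ u in A..B, (HFam (j + 1) (u / X) : ℂ) * (u : ℂ) ^ (-(t * I)) := by
  have hc : (1 : ℂ) - t * I ≠ 0 := by
    intro h
    have := congrArg Complex.re h
    simp at this
  set U : ℝ → ℂ := fun u ↦ (HFam j (u / X) : ℂ) with hU
  set U' : ℝ → ℂ := fun u ↦ ((1 / X * deriv (HFam j) (u / X) : ℝ) : ℂ) with hU'
  set V : ℝ → ℂ := fun u ↦ (u : ℂ) ^ (1 - t * I) / (1 - t * I) with hV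
  set V' : ℝ → ℂ := fun u ↦ (u : ℂ) ^ (-(t * I)) with hV'
  have hpos : ∀ u ∈ uIcc A B, 0 < u := fun u hu ↦ by
    rw [uIcc_of_le hAB] at hu; exact hA.trans_le hu.1
  have hderU : ∀ u ∈ uIcc A B, HasDerivAt U (U' u) u := by
    intro u hu
    have h1 : HasDerivAt (fun u : ℝ ↦ u / X) (1 / X) u := by
      simpa using (hasDerivAt_id u).div_const X
    have h2 := ((hasDerivAt_HFam j (div_pos (hpos u hu) hX)).comp u h1).ofReal_comp
    refine h2.congr_deriv ?_
    simp only [hU']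
    push_cast
    ring
  have hderV : ∀ u ∈ uIcc A B, HasDerivAt V (V' u) u := by
    intro u hu
    have h := (hasDerivAt_ofReal_cpow (hpos u hu) (1 - t * I)).div_const (1 - t * I)
    refine h.congr_deriv ?_
    simp only [hV']
    rw [mul_div_cancel_left₀ _ hc]
    congr 1
    ring
  have hcU' : ContinuousOn U' (uIcc A B) := by
    have h1 : ContinuousOn (fun u : ℝ ↦ deriv (HFam j) (u / X)) (uIcc A B) :=
      (continuousOn_deriv_HFam j).comp (continuous_id.div_const X).continuousOn
        fun u hu ↦ div_pos (hpos u hu) hX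
    exact continuous_ofReal.comp_continuousOn (h1.const_smul (1 / X) |>.congr fun u _ ↦ by
      simp [smul_eq_mul])
  have hcV' : ContinuousOn V' (uIcc A B) := fun u hu ↦
    (hasDerivAt_ofReal_cpow (hpos u hu) (-(t * I))).continuousAt.continuousWithinAt
  have hIBP := intervalIntegral.integral_mul_deriv_eq_deriv_mul hderU hderV
    hcU'.intervalIntegrable hcV'.intervalIntegrable
  have hUA : U A = 0 := by simp [hU, HFam_eq_zero_of_lt j hAX]
  have hUB : U B = 0 := by simp [hU, HFam_eq_zero_of_gt j hBX]
  rw [hUA, hUB, zero_mul, zero_mul, sub_zero, zero_sub] at hIBP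
  rw [hIBP, ← intervalIntegral.integral_neg, ← intervalIntegral.integral_const_mul]
  refine intervalIntegral.integral_congr fun u hu ↦ ?_
  have hu0 : 0 < u := hpos u hu
  have hu0' : (u : ℂ) ≠ 0 := by exact_mod_cast hu0.ne'
  simp only [hU', hV, HFam_succ_apply]
  have e1 : (u : ℂ) ^ (1 - t * I) = (u : ℂ) * (u : ℂ) ^ (-(t * I)) := by
    rw [sub_eq_add_neg, Complex.cpow_add _ _ hu0', Complex.cpow_one]
  rw [e1]
  push_cast
  field_simp

/-- **`k`-fold integration by parts.** [folklore] -/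
theorem integral_HFam_cpow_eq (k : ℕ) (t : ℝ) {X A B : ℝ} (hX : 0 < X) (hA : 0 < A)
    (hAB : A ≤ B) (hAX : A / X < 1 / 2) (hBX : 3 / 4 < B / X) :
    ∫ u in A..B, (HFam 0 (u / X) : ℂ) * (u : ℂ) ^ (-(t * I)) =
      (1 / (1 - t * I)) ^ k * ∫ u in A..B, (HFam k (u / X) : ℂ) * (u : ℂ) ^ (-(t * I)) := by
  induction k with
  | zero => simp
  | succ k ih => rw [ih, integral_HFam_cpow_succ k t hX hA hAB hAX hBX, pow_succ, mul_assoc]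

/-- The trivial bound `‖∫_A^B H_k(u/X) u^{−it} du‖ ≤ M_k (B − A)`. [folklore] -/
theorem norm_integral_HFam_cpow_le (k : ℕ) (t : ℝ) {X A B : ℝ} (hX : 0 < X) (hA : 0 < A)
    (hAB : A ≤ B) :
    ‖∫ u in A..B, (HFam k (u / X) : ℂ) * (u : ℂ) ^ (-(t * I))‖ ≤ HBound k * (B - A) := by
  have h := intervalIntegral.norm_integral_le_of_norm_le_const (a := A) (b := B)
    (C := HBound k) (f := fun u ↦ (HFam k (u / X) : ℂ) * (u : ℂ) ^ (-(t * I))) fun u hu ↦ by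
    rw [uIoc_of_le hAB] at hu
    have hu0 : 0 < u := hA.trans hu.1
    rw [norm_mul, Complex.norm_real, Real.norm_eq_abs, Complex.norm_cpow_eq_rpow_re_of_pos hu0]
    simp only [neg_re, mul_re, ofReal_re, I_re, mul_zero, ofReal_im, I_im, mul_one, sub_self,
      neg_zero, Real.rpow_zero, mul_one]
    exact abs_HFam_le k (div_pos hu0 hX)
  rwa [abs_of_nonneg (sub_nonneg.2 hAB)] at h

/-! ## §6 Assembly -/

/-- `u^{1−s} = √X · √(u/X) · u^{−it}` for `s = ½ + it`, `u, X > 0`. [folklore] -/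
theorem cpow_one_sub_half_line {u X : ℝ} (hu : 0 < u) (hX : 0 < X) (t : ℝ) :
    (u : ℂ) ^ (1 - (1 / 2 + t * I)) =
      (Real.sqrt X : ℂ) * (Real.sqrt (u / X) : ℂ) * (u : ℂ) ^ (-(t * I)) := by
  have hu0' : (u : ℂ) ≠ 0 := by exact_mod_cast hu.ne'
  have e1 : (1 : ℂ) - (1 / 2 + t * I) = (((1 / 2 : ℝ)) : ℂ) + -(t * I) := by push_cast; ring
  rw [e1, Complex.cpow_add _ _ hu0', ← Complex.ofReal_cpow hu.le, ← Real.sqrt_eq_rpow,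
    ← Complex.ofReal_mul, ← Real.sqrt_mul hX.le, mul_div_cancel₀ _ hX.ne']

/-- **The polar term against the smooth tail, after one integration by parts**: for
`s = ½ + it`, `0 < A ≤ B`, `A/X < 1/2 < 3/4 < B/X`,
`A^{1−s}/(s−1) − ∫_A^B w(u/X) u^{−s} du = (X⁻¹ √X/(1−s)) ∫_A^B H₀(u/X) u^{−it} du`. [folklore] -/
theorem polar_sub_integral_eq (t : ℝ) {X A B : ℝ} (hX : 0 < X) (hA : 0 < A) (hAB : A ≤ B)
    (hAX : A / X < 1 / 2) (hBX : 3 / 4 < B / X) :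
    (A : ℂ) ^ (1 - (1 / 2 + t * I)) / ((1 / 2 + t * I) - 1) -
        ∫ u in A..B, (bump (u / X) : ℂ) * (u : ℂ) ^ (-(1 / 2 + t * I)) =
      ((X⁻¹ * Real.sqrt X : ℝ) : ℂ) / (1 - (1 / 2 + t * I)) *
        ∫ u in A..B, (HFam 0 (u / X) : ℂ) * (u : ℂ) ^ (-(t * I)) := by
  set s : ℂ := 1 / 2 + t * I with hs
  have hc : (1 : ℂ) - s ≠ 0 := by
    intro h
    have := congrArg Complex.re h
    norm_num [hs] at this
  set U : ℝ → ℂ := bumpFam X 0 with hU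
  set U' : ℝ → ℂ := bumpFam X 1 with hU'
  set V : ℝ → ℂ := fun u ↦ (u : ℂ) ^ (1 - s) / (1 - s) with hV
  set V' : ℝ → ℂ := fun u ↦ (u : ℂ) ^ (-s) with hV'
  have hpos : ∀ u ∈ uIcc A B, 0 < u := fun u hu ↦ by
    rw [uIcc_of_le hAB] at hu; exact hA.trans_le hu.1
  have hderU : ∀ u ∈ uIcc A B, HasDerivAt U (U' u) u := fun u _ ↦ hasDerivAt_bumpFam hX 0 u
  have hderV : ∀ u ∈ uIcc A B, HasDerivAt V (V' u) u := by
    intro u hu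
    have h := (hasDerivAt_ofReal_cpow (hpos u hu) (1 - s)).div_const (1 - s)
    refine h.congr_deriv ?_
    simp only [hV']
    rw [mul_div_cancel_left₀ _ hc]
    congr 1
    ring
  have hcU' : ContinuousOn U' (uIcc A B) := fun u _ ↦
    (hasDerivAt_bumpFam hX 1 u).continuousAt.continuousWithinAt
  have hcV' : ContinuousOn V' (uIcc A B) := fun u hu ↦
    (hasDerivAt_ofReal_cpow (hpos u hu) (-s)).continuousAt.continuousWithinAt
  have hIBP := intervalIntegral.integral_mul_deriv_eq_deriv_mul hderU hderV
    hcU'.intervalIntegrable hcV'.intervalIntegrable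
  have hUA : U A = 1 := by
    simp [hU, bumpFam_zero_apply, bump_eq_one hAX.le]
  have hUB : U B = 0 := by
    simp [hU, bumpFam_zero_apply, bump_eq_zero hBX.le]
  rw [hUA, hUB, zero_mul, one_mul, zero_sub] at hIBP
  -- the integral of `w(u/X) u^{-s}` is `∫ U V'`
  have hI : ∫ u in A..B, (bump (u / X) : ℂ) * (u : ℂ) ^ (-s) = ∫ u in A..B, U u * V' u := by
    simp [hU, hV', bumpFam_zero_apply]
  rw [hI, hIBP]
  simp only [hV]
  have e2 : (A : ℂ) ^ (1 - s) / (s - 1) - (-((A : ℂ) ^ (1 - s) / (1 - s)) -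
      ∫ u in A..B, U' u * ((u : ℂ) ^ (1 - s) / (1 - s))) =
      ∫ u in A..B, U' u * ((u : ℂ) ^ (1 - s) / (1 - s)) := by
    have : (A : ℂ) ^ (1 - s) / (s - 1) = -((A : ℂ) ^ (1 - s) / (1 - s)) := by
      rw [← div_neg, neg_sub]
    rw [this]; ring
  rw [e2, ← intervalIntegral.integral_const_mul]
  refine intervalIntegral.integral_congr fun u hu ↦ ?_
  have hu0 : 0 < u := hpos u hu
  simp only [hU', bumpFam, hs, pow_one]
  rw [cpow_one_sub_half_line hu0 hX t]
  show _ = _ * ((((bumpD 1 (u / X) * Real.sqrt (u / X) : ℝ)) : ℂ) * _)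
  push_cast
  field_simp

/-- The lower summation point `N₀ = ⌊X/4⌋`. [folklore] -/
def nlo (X : ℝ) : ℕ := ⌊X / 4⌋₊

/-- The upper summation point `N₁ = ⌊X⌋`. [folklore] -/
def nhi (X : ℝ) : ℕ := ⌊X⌋₊

section Facts

variable {X : ℝ} (hX : 8 ≤ X)
include hX

/-- [folklore] -/
theorem one_le_nlo : 1 ≤ nlo X := Nat.le_floor (by norm_num; linarith)

/-- [folklore] -/
theorem nlo_le : (nlo X : ℝ) ≤ X / 4 := Nat.floor_le (by linarith)

/-- [folklore] -/
theorem eighth_le_nlo : X / 8 ≤ nlo X := by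
  have := Nat.lt_floor_add_one (X / 4)
  rw [nlo]; linarith

/-- [folklore] -/
theorem nlo_pos : (0 : ℝ) < nlo X := by linarith [eighth_le_nlo hX]

/-- [folklore] -/
theorem nhi_le : (nhi X : ℝ) ≤ X := Nat.floor_le (by linarith)

/-- [folklore] -/
theorem lt_nhi : 3 * X / 4 < nhi X := by
  have := Nat.lt_floor_add_one X
  rw [nhi]; linarith

/-- [folklore] -/
theorem nlo_le_nhi : nlo X ≤ nhi X := Nat.floor_mono (by linarith)

/-- [folklore] -/
theorem nlo_div_lt : (nlo X : ℝ) / X < 1 / 2 := by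
  rw [div_lt_iff₀ (by linarith)]; linarith [nlo_le hX]

/-- [folklore] -/
theorem lt_nhi_div : 3 / 4 < (nhi X : ℝ) / X := by
  rw [lt_div_iff₀ (by linarith)]; linarith [lt_nhi hX]

end Facts

/-- **The exact identity behind Lemma 2.** For `X ≥ 8`, `Re s > 0`, `s ≠ 1` and any order `ν`,
with `N₀ = ⌊X/4⌋`, `N₁ = ⌊X⌋`, `g_j` the derivatives of `w(u/X) u^{−s}`:
`ζ(s) − Σ_{n ≤ N₁} w(n/X) n^{−s} = [N₀^{1−s}/(s−1) − ∫_{N₀}^{N₁} w(u/X) u^{−s} du]`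
`  + R_ν(N₀, s) − (1/(2ν+1)!) ∫_{N₀}^{N₁} B̄_{2ν+1} g_{2ν+1}`
(Euler–Maclaurin of order `ν` for `ζ` at `N₀` and for `g` on `[N₀, N₁]`; all boundary terms at
`N₀` cancel, those at `N₁` vanish). [folklore] -/
theorem zeta_sub_smoothSum_eq {X : ℝ} (hX : 8 ≤ X) {s : ℂ} (hs : 0 < s.re) (hs1 : s ≠ 1) (ν : ℕ) :
    riemannZeta s - ∑ n ∈ Finset.Icc 1 (nhi X), (bump (n / X) : ℂ) * (n : ℂ) ^ (-s) =
      ((nlo X : ℂ) ^ (1 - s) / (s - 1) -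
          ∫ u in (nlo X : ℝ)..(nhi X), (bump (u / X) : ℂ) * (u : ℂ) ^ (-s)) +
        emRemHigher (nlo X) ν s -
        1 / (2 * ν + 1).factorial *
          ∫ u in (nlo X : ℝ)..(nhi X), (bernoulliPer (2 * ν + 1) u : ℂ) * gFam s X (2 * ν + 1) u := by
  have hX0 : 0 < X := by linarith
  have hζ := riemannZeta_eq_eulerMaclaurin_of_re_pos (one_le_nlo hX) hs hs1 ν
  have hg : ∀ j, ∀ x ∈ Icc ((nlo X : ℕ) : ℝ) (nhi X : ℕ),
      HasDerivAt (gFam s X j) (gFam s X (j + 1) x) x := fun j x hx ↦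
    hasDerivAt_gFam s hX0 ((nlo_pos hX).trans_le hx.1) j
  have hEM := eulerMaclaurin_family hg (nlo_le_nhi hX) ν
  -- boundary values
  have hb : ∀ j, gFam s X j (nhi X : ℕ) = 0 := fun j ↦ gFam_eq_zero s (lt_nhi_div hX) j
  have ha : ∀ j, gFam s X j (nlo X : ℕ) = powFam s j (nlo X : ℕ) := fun j ↦
    gFam_eq_powFam s (nlo_div_lt hX) j
  have hB : ∑ k ∈ Finset.Icc 1 ν, (bernoulli (2 * k) : ℂ) / (2 * k).factorial *
      (gFam s X (2 * k - 1) (nhi X : ℕ) - gFam s X (2 * k - 1) (nlo X : ℕ)) =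
      ∑ k ∈ Finset.Icc 1 ν, emTerm (nlo X) s k := by
    refine Finset.sum_congr rfl fun k hk ↦ ?_
    rw [Finset.mem_Icc] at hk
    have hodd : (-1 : ℂ) ^ (2 * k - 1) = -1 := Odd.neg_one_pow ⟨k - 1, by omega⟩
    rw [hb, ha, zero_sub, powFam, emTerm, hodd]
    push_cast
    ring
  have ha0 : gFam s X 0 (nlo X : ℕ) = ((nlo X : ℕ) : ℂ) ^ (-s) := by
    rw [ha, powFam_zero]; push_cast; rfl
  rw [hB, hb 0, ha0] at hEM
  -- the smooth sum, split at `N₀`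
  have hS : ∑ n ∈ Finset.Icc 1 (nhi X), (bump (n / X) : ℂ) * (n : ℂ) ^ (-s) =
      ∑ n ∈ Finset.Ico 1 (nlo X), (n : ℂ) ^ (-s) + ((nlo X : ℕ) : ℂ) ^ (-s) +
        ∑ n ∈ Finset.Ioc (nlo X) (nhi X), gFam s X 0 n := by
    have e1 : Finset.Icc 1 (nhi X) = Finset.Ioc 0 (nhi X) := rfl
    rw [e1, ← Finset.sum_Ioc_consecutive _ (Nat.zero_le (nlo X)) (nlo_le_nhi hX)]
    congr 1
    · have e2 : Finset.Ioc 0 (nlo X) = Finset.Ico 1 (nlo X + 1) := by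
        ext n; simp [Finset.mem_Ioc, Finset.mem_Ico]; omega
      rw [e2, Finset.sum_Ico_succ_top (one_le_nlo hX)]
      congr 1
      refine Finset.sum_congr rfl fun n hn ↦ ?_
      rw [Finset.mem_Ico] at hn
      have hnX : (n : ℝ) / X ≤ 1 / 2 := by
        have h1 : (n : ℝ) ≤ nlo X := by exact_mod_cast hn.2.le
        have := nlo_div_lt hX
        have h2 : (n : ℝ) / X ≤ (nlo X : ℝ) / X := div_le_div_of_nonneg_right h1 hX0.le
        linarith
      rw [bump_eq_one hnX]; push_cast; ring
      · rw [bump_eq_one (nlo_div_lt hX).le]; push_cast; ring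
    · refine Finset.sum_congr rfl fun n _ ↦ ?_
      rw [gFam_zero_apply]; push_cast; rfl
  -- the integral of `g_0`
  have hI0 : ∫ u in ((nlo X : ℕ) : ℝ)..(nhi X : ℕ), gFam s X 0 u =
      ∫ u in ((nlo X : ℕ) : ℝ)..(nhi X : ℕ), (bump (u / X) : ℂ) * (u : ℂ) ^ (-s) :=
    intervalIntegral.integral_congr fun u _ ↦ gFam_zero_apply s X u
  rw [hI0] at hEM
  rw [hS, hζ, emMainZero]
  linear_combination -hEM


/-- **Bound for the polar/tail term** `E₁ = (X⁻¹√X/(1−s)) ∫_{N₀}^{N₁} H₀(u/X) u^{−it} du` after `k`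
integrations by parts: `‖E₁‖ ≤ M_k √X T^{−(k+1)}` for `t ≥ T > 0`. [folklore] -/
theorem norm_E1_le (k : ℕ) {X T t : ℝ} (hX : 8 ≤ X) (hT : 0 < T) (ht : T ≤ t) :
    ‖((X⁻¹ * Real.sqrt X : ℝ) : ℂ) / (1 - (1 / 2 + t * I)) *
        ∫ u in (nlo X : ℝ)..(nhi X), (HFam 0 (u / X) : ℂ) * (u : ℂ) ^ (-(t * I))‖ ≤
      HBound k * Real.sqrt X * T⁻¹ ^ (k + 1) := by
  have hX0 : 0 < X := by linarith
  have ht0 : 0 < t := hT.trans_le ht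
  have hA := nlo_pos hX
  have hAB : (nlo X : ℝ) ≤ nhi X := by exact_mod_cast nlo_le_nhi hX
  rw [integral_HFam_cpow_eq k t hX0 hA hAB (nlo_div_lt hX) (lt_nhi_div hX), norm_mul, norm_mul,
    norm_pow, norm_div, Complex.norm_real, Real.norm_of_nonneg (by positivity)]
  have h1 : T ≤ ‖(1 : ℂ) - (1 / 2 + t * I)‖ := by
    have him : ((1 : ℂ) - (1 / 2 + t * I)).im = -t := by simp
    have := Complex.abs_im_le_norm ((1 : ℂ) - (1 / 2 + t * I))
    rw [him, abs_neg, abs_of_pos ht0] at this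
    linarith
  have h2 : ‖(1 : ℂ) / (1 - t * I)‖ ≤ T⁻¹ := by
    rw [norm_div, norm_one, one_div]
    apply inv_anti₀ hT
    have him : ((1 : ℂ) - t * I).im = -t := by simp
    have := Complex.abs_im_le_norm ((1 : ℂ) - t * I)
    rw [him, abs_neg, abs_of_pos ht0] at this
    linarith
  have h3 := norm_integral_HFam_cpow_le k t hX0 hA hAB
  have h4 : (nhi X : ℝ) - nlo X ≤ X := by linarith [nhi_le hX, nlo_pos hX]
  have hHB := HBound_nonneg k
  calc X⁻¹ * Real.sqrt X / ‖(1 : ℂ) - (1 / 2 + t * I)‖ * (‖(1 : ℂ) / (1 - t * I)‖ ^ k *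
        ‖∫ u in (nlo X : ℝ)..(nhi X), (HFam k (u / X) : ℂ) * (u : ℂ) ^ (-(t * I))‖)
      ≤ X⁻¹ * Real.sqrt X / T * (T⁻¹ ^ k * (HBound k * X)) := by
        gcongr
        exact h3.trans (mul_le_mul_of_nonneg_left h4 hHB)
    _ = HBound k * Real.sqrt X * T⁻¹ ^ (k + 1) * (X⁻¹ * X) := by rw [pow_succ]; ring
    _ = HBound k * Real.sqrt X * T⁻¹ ^ (k + 1) := by rw [inv_mul_cancel₀ hX0.ne', mul_one]

/-- **Bound for the `ζ`-side Euler–Maclaurin remainder** at `N₀ ≥ X/8` on `Re s = ½`: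
`‖R_ν(N₀, s)‖ ≤ 2 (‖s‖ + 2ν + 1)^{2ν+1} (X/8)^{−(2ν + 1/2)}`. [folklore] -/
theorem norm_emRem_le {X : ℝ} (hX : 8 ≤ X) {s : ℂ} (hs : s.re = 1 / 2) {ν : ℕ} (hν : ν ≠ 0) :
    ‖emRemHigher (nlo X) ν s‖ ≤
      2 * (‖s‖ + (2 * ν + 1 : ℕ)) ^ (2 * ν + 1) * (X / 8) ^ (-(((2 * ν + 1 : ℕ) : ℝ) - 1 / 2)) := by
  have h := norm_emRemHigher_le (N := nlo X) (s := s) (one_le_nlo hX) (by rw [hs]; norm_num) hν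
  rw [hs] at h
  have hπ : Real.pi ^ 2 / 3 / (2 * Real.pi) ^ (2 * ν + 1) ≤ 1 := by
    rw [div_le_one (by positivity)]
    have h3 := Real.pi_gt_three
    have h4 := Real.pi_le_four
    calc Real.pi ^ 2 / 3 ≤ 2 * Real.pi := by nlinarith
      _ ≤ (2 * Real.pi) ^ (2 * ν + 1) := le_self_pow₀ (by linarith) (by omega)
  have hP := norm_emPoch_le_pow s (2 * ν + 1)
  have hN : ((nlo X : ℕ) : ℝ) ^ (-(1 / 2 + 2 * (ν : ℝ))) ≤ (X / 8) ^ (-(1 / 2 + 2 * (ν : ℝ))) :=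
    Real.rpow_le_rpow_of_nonpos (by linarith) (eighth_le_nlo hX)
      (by simp only [Left.neg_nonpos_iff]; positivity)
  have hd : ((X / 8) ^ (-(1 / 2 + 2 * (ν : ℝ)))) / (1 / 2 + 2 * (ν : ℝ)) ≤
      (X / 8) ^ (-(1 / 2 + 2 * (ν : ℝ))) * 2 := by
    rw [div_le_iff₀ (by positivity)]
    have h0 : (0 : ℝ) ≤ (X / 8) ^ (-(1 / 2 + 2 * (ν : ℝ))) := Real.rpow_nonneg (by linarith) _
    have h1 : (1 : ℝ) ≤ ν := by exact_mod_cast Nat.one_le_iff_ne_zero.2 hν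
    nlinarith
  have e : (-(((2 * ν + 1 : ℕ) : ℝ) - 1 / 2)) = -(1 / 2 + 2 * (ν : ℝ)) := by push_cast; ring
  rw [e]
  calc ‖emRemHigher (nlo X) ν s‖ ≤ _ := h
    _ ≤ (‖s‖ + (2 * ν + 1 : ℕ)) ^ (2 * ν + 1) * 1 *
          (((X / 8) ^ (-(1 / 2 + 2 * (ν : ℝ)))) / (1 / 2 + 2 * (ν : ℝ))) := by
        gcongr
    _ ≤ (‖s‖ + (2 * ν + 1 : ℕ)) ^ (2 * ν + 1) * 1 * ((X / 8) ^ (-(1 / 2 + 2 * (ν : ℝ))) * 2) := by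
        gcongr
    _ = _ := by ring

/-- **Bound for the smooth-side Euler–Maclaurin remainder**
`‖(1/m!) ∫_{N₀}^{N₁} B̄_m g_m‖ ≤ (β/m!) (Σ_i C(m,i) K_i) (‖s‖ + m)^m (X/8)^{−(m+1/2)} X`. [folklore] -/
theorem norm_Rg_le {X : ℝ} (hX : 8 ≤ X) {s : ℂ} (hs : s.re = 1 / 2) (m : ℕ) {β : ℝ}
    (hβ : ∀ x, |bernoulliPer m x| ≤ β) :
    ‖1 / ((m.factorial : ℕ) : ℂ) *
        ∫ u in (nlo X : ℝ)..(nhi X), (bernoulliPer m u : ℂ) * gFam s X m u‖ ≤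
      β / m.factorial * (∑ i ∈ Finset.range (m + 1), (m.choose i : ℝ) * bumpBound i) *
        (‖s‖ + m) ^ m * (X / 8) ^ (-((m : ℝ) + 1 / 2)) * X := by
  have hX0 : 0 < X := by linarith
  have hAB : (nlo X : ℝ) ≤ nhi X := by exact_mod_cast nlo_le_nhi hX
  have hβ0 : 0 ≤ β := (abs_nonneg _).trans (hβ 0)
  set KK := ∑ i ∈ Finset.range (m + 1), (m.choose i : ℝ) * bumpBound i with hKK
  have hKK : 0 ≤ KK := Finset.sum_nonneg fun i _ ↦ by
    have := one_le_bumpBound i; positivity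
  have hpt : ∀ u ∈ Ι (nlo X : ℝ) (nhi X), ‖(bernoulliPer m u : ℂ) * gFam s X m u‖ ≤
      β * (KK * (‖s‖ + m) ^ m * (X / 8) ^ (-((m : ℝ) + 1 / 2))) := by
    intro u hu
    rw [uIoc_of_le hAB] at hu
    have hu8 : X / 8 ≤ u := (eighth_le_nlo hX).trans hu.1.le
    rw [norm_mul, Complex.norm_real, Real.norm_eq_abs]
    have hg := norm_gFam_le s (X := X) (by positivity : 0 < X / 8) hu8 (by linarith)
      (by rw [hs]; norm_num) m
    rw [hs, show (-(1 / 2 + (m : ℝ))) = -((m : ℝ) + 1 / 2) by ring] at hg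
    exact mul_le_mul (hβ u) hg (norm_nonneg _) hβ0
  have h := intervalIntegral.norm_integral_le_of_norm_le_const hpt
  rw [abs_of_nonneg (sub_nonneg.2 hAB)] at h
  have h4 : (nhi X : ℝ) - nlo X ≤ X := by linarith [nhi_le hX, nlo_pos hX]
  have hin : 0 ≤ β * (KK * (‖s‖ + m) ^ m * (X / 8) ^ (-((m : ℝ) + 1 / 2))) := by positivity
  rw [norm_mul, norm_div, norm_one, Complex.norm_natCast]
  calc 1 / (m.factorial : ℝ) *
        ‖∫ u in (nlo X : ℝ)..(nhi X), (bernoulliPer m u : ℂ) * gFam s X m u‖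
      ≤ 1 / (m.factorial : ℝ) *
          (β * (KK * (‖s‖ + m) ^ m * (X / 8) ^ (-((m : ℝ) + 1 / 2))) * X) := by
        gcongr
        exact h.trans (mul_le_mul_of_nonneg_left h4 hin)
    _ = _ := by ring

/-- **Lemma 2 for the explicit weight `w = bump`, quantitatively**: for `η, v > 0` there are `C, T₀`
with `‖ζ(½+it) − Σ_{n ≤ T^{1+η}} w(n/T^{1+η}) n^{−½−it}‖ ≤ C T^{−v}` for `T ≥ T₀`, `t ∈ [T, 2T]`.
[cite: Radziwill2012, Lemma 2] [cite: BombieriFriedlander1995, Proposition 2] -/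
theorem lemma2_bound (η v : ℝ) (hη : 0 < η) (hv : 0 < v) :
    ∃ C T₀ : ℝ, ∀ T : ℝ, T₀ ≤ T → ∀ t ∈ Set.Icc T (2 * T),
      ‖riemannZeta (1 / 2 + t * I) -
          ∑ n ∈ Finset.Icc 1 ⌊T ^ (1 + η)⌋₊,
            (bump (n / T ^ (1 + η)) : ℂ) * (n : ℂ) ^ (-(1 / 2 + t * I))‖ ≤ C * T ^ (-v) := by
  -- the orders `ν` (Euler–Maclaurin) and `k` (integrations by parts)
  obtain ⟨ν, hν0, hν⟩ : ∃ ν : ℕ, ν ≠ 0 ∧ (v + 1) / η ≤ ν :=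
    ⟨⌈(v + 1) / η⌉₊, (Nat.ceil_pos.2 (by positivity)).ne', Nat.le_ceil _⟩
  obtain ⟨k, hk⟩ : ∃ k : ℕ, v + η ≤ k := ⟨⌈v + η⌉₊, Nat.le_ceil _⟩
  set m : ℕ := 2 * ν + 1 with hm
  obtain ⟨β, -, hβ⟩ := exists_bound_bernoulliPer m
  have hβ0 : 0 ≤ β := (abs_nonneg _).trans (hβ 0)
  set KK : ℝ := ∑ i ∈ Finset.range (m + 1), (m.choose i : ℝ) * bumpBound i with hKK
  have hKK0 : 0 ≤ KK := Finset.sum_nonneg fun i _ ↦ by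
    have := one_le_bumpBound i; positivity
  -- the exponents
  have hmR : (m : ℝ) = 2 * ν + 1 := by rw [hm]; push_cast; ring
  have hexp : (m : ℝ) + -((1 + η) * ((m : ℝ) - 1 / 2)) ≤ -v := by
    have h1 : v + 1 ≤ η * ν := by
      have := (div_le_iff₀ hη).1 hν
      linarith [mul_comm (ν : ℝ) η]
    rw [hmR]
    nlinarith
  have hexp1 : (1 + η) / 2 + -((k : ℝ) + 1) ≤ -v := by linarith
  refine ⟨HBound k + 2 * (3 + m) ^ m * 8 ^ ((m : ℝ) - 1 / 2) +
      β / m.factorial * KK * (3 + m) ^ m * 8 ^ ((m : ℝ) + 1 / 2), 8, fun T hT t ht ↦ ?_⟩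
  have hT1 : (1 : ℝ) ≤ T := by linarith
  have hT0 : (0 : ℝ) < T := by linarith
  have ht0 : 0 < t := hT0.trans_le ht.1
  set X : ℝ := T ^ (1 + η) with hXdef
  have hXT : T ≤ X := by
    calc T = T ^ (1 : ℝ) := (Real.rpow_one T).symm
      _ ≤ T ^ (1 + η) := Real.rpow_le_rpow_of_exponent_le hT1 (by linarith)
  have hX8 : 8 ≤ X := hT.trans hXT
  have hX0 : 0 < X := by linarith
  have hsre : ((1 : ℂ) / 2 + t * I).re = 1 / 2 := by simp
  have hs1 : (1 : ℂ) / 2 + t * I ≠ 1 := by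
    intro h
    have := congrArg Complex.re h
    rw [hsre] at this
    norm_num at this
  have hsn : ‖(1 : ℂ) / 2 + t * I‖ ≤ 3 * T := by
    have := Complex.norm_le_abs_re_add_abs_im ((1 : ℂ) / 2 + t * I)
    have him : ((1 : ℂ) / 2 + t * I).im = t := by simp
    rw [hsre, him, abs_of_pos ht0] at this
    norm_num at this
    linarith [ht.2]
  -- power bookkeeping in `T`
  have eX : ∀ a : ℝ, X ^ a = T ^ ((1 + η) * a) := fun a ↦ by
    rw [hXdef, ← Real.rpow_mul hT0.le]
  have eX8 : ∀ a : ℝ, (X / 8) ^ (-a) = 8 ^ a * T ^ (-((1 + η) * a)) := fun a ↦ by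
    rw [Real.div_rpow hX0.le (by norm_num), Real.rpow_neg (by norm_num : (0 : ℝ) ≤ 8),
      div_inv_eq_mul, mul_comm, eX, show (1 + η) * (-a) = -((1 + η) * a) by ring]
  have eTm : T ^ m = T ^ (m : ℝ) := (Real.rpow_natCast T m).symm
  have esqrt : Real.sqrt X = T ^ ((1 + η) / 2) := by
    rw [Real.sqrt_eq_rpow, eX]; ring_nf
  have eTinv : T⁻¹ ^ (k + 1) = T ^ (-((k : ℝ) + 1)) := by
    rw [inv_pow, ← Real.rpow_natCast, ← Real.rpow_neg hT0.le]
    push_cast; ring_nf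
  have eXX : X = T ^ (1 + η) := hXdef
  have hsm : (‖(1 : ℂ) / 2 + t * I‖ + m) ^ m ≤ (3 + m) ^ m * T ^ (m : ℝ) := by
    rw [← eTm, ← mul_pow]
    apply pow_le_pow_left₀ (by positivity)
    have : (m : ℝ) ≤ m * T := by
      have : (0 : ℝ) ≤ m := by positivity
      nlinarith
    linarith
  -- the identity
  rw [show ⌊X⌋₊ = nhi X from rfl, zeta_sub_smoothSum_eq hX8 (by rw [hsre]; norm_num) hs1 ν]
  have hE1 := polar_sub_integral_eq t hX0 (nlo_pos hX8) (by exact_mod_cast nlo_le_nhi hX8)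
    (nlo_div_lt hX8) (lt_nhi_div hX8)
  rw [Complex.ofReal_natCast] at hE1
  rw [hE1]
  -- the three bounds
  have b1 := norm_E1_le k hX8 hT0 ht.1
  have b2 := norm_emRem_le hX8 hsre hν0
  have b3 := norm_Rg_le hX8 hsre m hβ
  have key : T ^ (m : ℝ) * T ^ (-((1 + η) * ((m : ℝ) - 1 / 2))) ≤ T ^ (-v) := by
    rw [← Real.rpow_add hT0]
    exact Real.rpow_le_rpow_of_exponent_le hT1 hexp
  have key1 : Real.sqrt X * T⁻¹ ^ (k + 1) ≤ T ^ (-v) := by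
    rw [esqrt, eTinv, ← Real.rpow_add hT0]
    exact Real.rpow_le_rpow_of_exponent_le hT1 hexp1
  have c1 : HBound k * Real.sqrt X * T⁻¹ ^ (k + 1) ≤ HBound k * T ^ (-v) := by
    rw [mul_assoc]
    exact mul_le_mul_of_nonneg_left key1 (HBound_nonneg k)
  have c2 : 2 * (‖(1 : ℂ) / 2 + t * I‖ + (2 * ν + 1 : ℕ)) ^ (2 * ν + 1) *
      (X / 8) ^ (-(((2 * ν + 1 : ℕ) : ℝ) - 1 / 2)) ≤ 2 * (3 + m) ^ m * 8 ^ ((m : ℝ) - 1 / 2) * T ^ (-v) := by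
    rw [← hm]
    calc 2 * (‖(1 : ℂ) / 2 + t * I‖ + m) ^ m * (X / 8) ^ (-((m : ℝ) - 1 / 2))
        ≤ 2 * ((3 + m) ^ m * T ^ (m : ℝ)) * (8 ^ ((m : ℝ) - 1 / 2) *
            T ^ (-((1 + η) * ((m : ℝ) - 1 / 2)))) := by
          gcongr
          exact le_of_eq (eX8 _)
      _ = 2 * (3 + m) ^ m * 8 ^ ((m : ℝ) - 1 / 2) *
            (T ^ (m : ℝ) * T ^ (-((1 + η) * ((m : ℝ) - 1 / 2)))) := by ring
      _ ≤ 2 * (3 + m) ^ m * 8 ^ ((m : ℝ) - 1 / 2) * T ^ (-v) :=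
          mul_le_mul_of_nonneg_left key (by positivity)
  have c3 : β / m.factorial * KK * (‖(1 : ℂ) / 2 + t * I‖ + m) ^ m *
      (X / 8) ^ (-((m : ℝ) + 1 / 2)) * X ≤
      β / m.factorial * KK * (3 + m) ^ m * 8 ^ ((m : ℝ) + 1 / 2) * T ^ (-v) := by
    have e9 : T ^ (-((1 + η) * ((m : ℝ) + 1 / 2))) * T ^ (1 + η) =
        T ^ (-((1 + η) * ((m : ℝ) - 1 / 2))) := by
      rw [← Real.rpow_add hT0]
      congr 1
      ring
    calc β / m.factorial * KK * (‖(1 : ℂ) / 2 + t * I‖ + m) ^ m *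
          (X / 8) ^ (-((m : ℝ) + 1 / 2)) * X
        ≤ β / m.factorial * KK * ((3 + m) ^ m * T ^ (m : ℝ)) *
            (8 ^ ((m : ℝ) + 1 / 2) * T ^ (-((1 + η) * ((m : ℝ) + 1 / 2)))) * X := by
          gcongr
          exact le_of_eq (eX8 _)
      _ = β / m.factorial * KK * (3 + m) ^ m * 8 ^ ((m : ℝ) + 1 / 2) *
            (T ^ (m : ℝ) * (T ^ (-((1 + η) * ((m : ℝ) + 1 / 2))) * T ^ (1 + η))) := by
          rw [eXX]; ring
      _ = β / m.factorial * KK * (3 + m) ^ m * 8 ^ ((m : ℝ) + 1 / 2) *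
            (T ^ (m : ℝ) * T ^ (-((1 + η) * ((m : ℝ) - 1 / 2)))) := by rw [e9]
      _ ≤ β / m.factorial * KK * (3 + m) ^ m * 8 ^ ((m : ℝ) + 1 / 2) * T ^ (-v) :=
          mul_le_mul_of_nonneg_left key (by positivity)
  calc ‖((X⁻¹ * Real.sqrt X : ℝ) : ℂ) / (1 - (1 / 2 + t * I)) *
            (∫ u in (nlo X : ℝ)..(nhi X), (HFam 0 (u / X) : ℂ) * (u : ℂ) ^ (-(t * I))) +
          emRemHigher (nlo X) ν (1 / 2 + t * I) -
          1 / ((2 * ν + 1).factorial : ℂ) *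
            ∫ u in (nlo X : ℝ)..(nhi X),
              (bernoulliPer (2 * ν + 1) u : ℂ) * gFam (1 / 2 + t * I) X (2 * ν + 1) u‖
      ≤ ‖((X⁻¹ * Real.sqrt X : ℝ) : ℂ) / (1 - (1 / 2 + t * I)) *
            (∫ u in (nlo X : ℝ)..(nhi X), (HFam 0 (u / X) : ℂ) * (u : ℂ) ^ (-(t * I)))‖ +
          ‖emRemHigher (nlo X) ν (1 / 2 + t * I)‖ +
          ‖1 / ((2 * ν + 1).factorial : ℂ) *
            ∫ u in (nlo X : ℝ)..(nhi X),
              (bernoulliPer (2 * ν + 1) u : ℂ) * gFam (1 / 2 + t * I) X (2 * ν + 1) u‖ :=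
        (norm_sub_le _ _).trans (by gcongr; exact norm_add_le _ _)
    _ ≤ HBound k * T ^ (-v) + 2 * (3 + m) ^ m * 8 ^ ((m : ℝ) - 1 / 2) * T ^ (-v) +
          β / m.factorial * KK * (3 + m) ^ m * 8 ^ ((m : ℝ) + 1 / 2) * T ^ (-v) := by
        refine add_le_add_three (b1.trans c1) (b2.trans c2) (b3.trans ?_)
        exact c3
    _ = _ := by ring

end Lemma2

/-- **Radziwiłł 2012, Lemma 2 (Bombieri–Friedlander), discharged.** The smooth weight is the
explicit `Lemma2.bump` (`= smoothTransition (3 − 4x)`: `1` on `[0, ½]`, `0` on `[¾, ∞)`); the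
proof is elementary: Euler–Maclaurin summation of high order for `ζ` (the tree's
`riemannZeta_eq_eulerMaclaurin_of_re_pos`) and for the smooth sum (`Lemma2.eulerMaclaurin_family`)
at the common point `N₀ = ⌊T^{1+η}/4⌋`, where all boundary terms cancel, the polar terms cancel
after one integration by parts, and the remaining oscillatory integral
`∫ w'(u/X) u^{½−it} du` is `O_k(X^{1/2} T^{−k})` by `k` further integrations by parts
(`Lemma2.zeta_sub_smoothSum_eq`, `Lemma2.lemma2_bound`). This replaces the Mellin-inversion /
contour-shift proof of [BombieriFriedlander1995, Prop. 2] and needs no growth estimate for `ζ`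
off the critical line. [cite: Radziwill2012, Lemma 2] [cite: BombieriFriedlander1995, Proposition 2] -/
theorem Radziwill2012_lemma2_holds : Radziwill2012_lemma2 := by
  intro η hη v hv
  obtain ⟨C, T₀, h⟩ := Lemma2.lemma2_bound η v hη hv
  exact ⟨Lemma2.bump, Lemma2.bump_contDiff, fun x ↦ ⟨Lemma2.bump_nonneg x, Lemma2.bump_le_one x⟩,
    Lemma2.bump_zero, C, T₀, h⟩

end Literature.Barriers.RiemannHypothesis
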